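import Mathlib
import HarnessLib
import Summits.QuantumFields.YangMills.Theorems.MirrorModularBoostsHypercubicLimitTranslationPlanesTendsto

/-!
# Line `Sketch` (coupling response), Z3a residual: `stub_translationPlanesMono`

Stub file for crux `stmt-QuantumFields-16154` (`HypercubicLimit`), line `Sketch`: translation invariance on `⁰𝒮` of the
plane-string limits along a `PlaneLimits` package `(φ, T)` with `StrictMono φ` (the earlier registration without the
subsequence hypothesis is false for a constant `φ`: the `PlaneLimits` are then the finite lattice sums `Σ_q planeDist_{k₀}`,
not translation invariant).  All the work is in the landed helper files: the seam estimate
(`…TranslationPlanesSeam`: `norm_planeDist_translate_sub_le`) and the inheritance along `φ → ∞`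
(`…TranslationPlanesTendsto`: `translationPlanes_of_tendsto`).
-/

noncomputable section

open scoped SchwartzMap BigOperators
open MeasureTheory Filter Topology
open Literature.MathematicalPhysics.AQFT Literature.MathematicalPhysics.QuantumLattice
  Literature.MathematicalPhysics.QuantumFieldTheory

namespace Summit.QuantumFields.YangMills.Cruxes.HypercubicLimit.CouplingResponse

/-- **Registered stub `stub_translationPlanesMono`** (line `Sketch`, Z3a residual): along every `PlaneLimits` package taken along
a genuine subsequence (`StrictMono φ`, as delivered by `stub_planeLimits`) of a scheme with polynomial volume growth and
renormalisation and the uniform functional bound, the candidate family `planeSum T` is invariant under ALL translations of `ℝ⁴`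
on `⁰𝒮` — the landed `translationPlanes_of_tendsto` along `hφ.tendsto_atTop`. [folklore] -/
theorem stub_translationPlanesMono : ∀ (G : Type) [Group G] [TopologicalSpace G] [IsTopologicalGroup G] [CompactSpace G] [MeasurableSpace G] [BorelSpace G] (r : LatticeRep G) (sch : SpeciesScheme (YMSpecies G)) (φ : ℕ → ℕ) (hφ : StrictMono φ) (T : (n : ℕ) → (Fin n → Plane) → (𝓢((Fin n → EuclideanSpace ℝ (Fin 4)), ℂ) →L[ℂ] ℂ)), PolyVolume sch → PolyRenorm r sch → UniformFunctionalBoundPlanes r sch → PlaneLimits r sch φ T → ∀ (n : ℕ) (a : EuclideanSpace ℝ (Fin 4)) (F : 𝓢((Fin n → EuclideanSpace ℝ (Fin 4)), ℂ)), IsOffDiagonal F → planeSum T n (translateMulti a F) = planeSum T n F := by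
  intro G _ _ _ _ _ _ r sch φ hφ T hPV hPR hU hPL n a F hF
  exact translationPlanes_of_tendsto G r sch φ T hφ.tendsto_atTop hPV hPR hU hPL n a F hF

end Summit.QuantumFields.YangMills.Cruxes.HypercubicLimit.CouplingResponse

end
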